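import Mathlib
import Summits.Schanuel.Schanuel.Theorems.AclSubsetLogFreeCore.Negative.ExpAclDefinability
import Summits.Schanuel.Schanuel.Theorems.AclSubsetLogFreeCore.Negative.LogFreeCoreCountable
import Summits.Schanuel.Schanuel.Theorems.AclSubsetLogFreeCore.Negative.LogTwoBranchRelations
import Summits.Schanuel.Schanuel.Theorems.AclSubsetLogFreeCore.Negative.CountableVariant

/-!
# Crux `AclSubsetLogFreeCore` — standard-kernel twist, part 1: linear algebra over `ℚ` inside `ℂ`

Support file (cdisprove gen 5) for `Negative/StandardKernelTwist.lean` ("the standard-kernel axioms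
do not force (A)"; crux stmt-Schanuel-0968).  Contents: (§2) the extension lemma — a bijection between
two countable `ℚ`-linearly independent subsets of `ℂ` extends to a `ℚ`-linear automorphism of `ℂ`
(Hamel bases; complements of countable sets in a basis have size `𝔠 = dim_ℚ ℂ`); (§3) the `ℚ`-subspace
`𝓛 = {z | e^z ∈ ℚ(π)^{ralg}}` of logarithms of `Kpi = ℚ(π)^{ralg}` (countable; closed under `z ↦ z/n`
because `Kpi` is relatively algebraically closed), and two infinite independent families: the powers
of `π` in `Kpi` (transcendence of `π`) and the logarithms of the primes in `𝓛` (unique factorisation,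
via `padicValRat`); (§4) the constants `τ = 2πi`, `ω = e^π`, `ln 2`, `ln 3` and the fact that `ω`
satisfies no quadratic relation over `Kpi` (Nesterenko: `exp_pi_not_mem_Kpi`).  All folklore.
-/

noncomputable section

set_option linter.dupNamespace false

open FirstOrder FirstOrder.Language Set Cardinal
open Literature.ModelTheory.ExponentialFields

namespace Summit.Schanuel.Schanuel.Theorems.AclSubsetLogFreeCore.Negative

namespace StandardKernelTwist

/-! ### 2. Extension lemma: a bijection of countable independent sets extends to `ℂ ≃ₗ[ℚ] ℂ` -/

/-- `dim_ℚ ℂ = 𝔠`. -/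
theorem rank_rat_complex : Module.rank ℚ ℂ = 𝔠 := by
  have h : Cardinal.lift.{0} #ℚ < Cardinal.lift.{0} #ℂ := by
    rw [Cardinal.lift_id, Cardinal.lift_id, Cardinal.mkRat, Cardinal.mk_complex]
    exact Cardinal.aleph0_lt_continuum
  rw [Module.Free.rank_eq_mk_of_infinite_lt ℚ ℂ h, Cardinal.mk_complex]

/-- A `ℚ`-basis of `ℂ` indexed by a set of complex numbers has `𝔠` elements. -/
theorem mk_eq_continuum_of_basis {B : Set ℂ} (b : Module.Basis B ℚ ℂ) : #B = 𝔠 := by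
  rw [b.mk_eq_rank'', rank_rat_complex]

/-- In such a basis the complement of a countable subset still has `𝔠` elements. -/
theorem mk_compl_eq_continuum {B : Set ℂ} (b : Module.Basis B ℚ ℂ) (s : Set B)
    (hs : s.Countable) : #(↥sᶜ) = 𝔠 := by
  have hB := mk_eq_continuum_of_basis b
  have : Infinite B := by
    rw [← Cardinal.aleph0_le_mk_iff, hB]; exact Cardinal.aleph0_le_continuum
  rw [← hB]
  apply Cardinal.mk_compl_of_infinite
  rw [hB]
  exact (Cardinal.le_aleph0_iff_set_countable.2 hs).trans_lt Cardinal.aleph0_lt_continuum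

/-- **Extension lemma.**  A bijection between two countable `ℚ`-linearly independent subsets of
`ℂ` extends to a `ℚ`-linear automorphism of `ℂ` (Hamel bases through them; the complements have
the same size `𝔠`). -/
theorem exists_linearEquiv_extend {I I' : Set ℂ} (hI : LinearIndepOn ℚ id I)
    (hI' : LinearIndepOn ℚ id I') (hIc : I.Countable) (hI'c : I'.Countable) (e : I ≃ I') :
    ∃ Φ : ℂ ≃ₗ[ℚ] ℂ, ∀ x : I, Φ x = e x := by
  classical
  let B : Set ℂ := hI.extend (Set.subset_univ I)
  let B' : Set ℂ := hI'.extend (Set.subset_univ I')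
  let b : Module.Basis B ℚ ℂ := Module.Basis.extend hI
  let b' : Module.Basis B' ℚ ℂ := Module.Basis.extend hI'
  have hIB : I ⊆ B := hI.subset_extend _
  have hIB' : I' ⊆ B' := hI'.subset_extend _
  let s : Set B := {x | (x : ℂ) ∈ I}
  let s' : Set B' := {x | (x : ℂ) ∈ I'}
  have hsc : s.Countable := by
    have : s = ((↑) : B → ℂ) ⁻¹' I := rfl
    rw [this]
    exact hIc.preimage Subtype.val_injective
  have hs'c : s'.Countable := by
    have : s' = ((↑) : B' → ℂ) ⁻¹' I' := rfl
    rw [this]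
    exact hI'c.preimage Subtype.val_injective
  let es : ↥s ≃ I :=
    { toFun := fun x => ⟨x.1.1, x.2⟩
      invFun := fun y => ⟨⟨y.1, hIB y.2⟩, y.2⟩
      left_inv := fun x => rfl
      right_inv := fun y => rfl }
  let es' : ↥s' ≃ I' :=
    { toFun := fun x => ⟨x.1.1, x.2⟩
      invFun := fun y => ⟨⟨y.1, hIB' y.2⟩, y.2⟩
      left_inv := fun x => rfl
      right_inv := fun y => rfl }
  have hcc : #(↥sᶜ) = #(↥s'ᶜ) := by
    rw [mk_compl_eq_continuum b s hsc, mk_compl_eq_continuum b' s' hs'c]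
  obtain ⟨f⟩ := Cardinal.eq.1 hcc
  let g : B ≃ B' :=
    (Equiv.Set.sumCompl s).symm.trans
      ((Equiv.sumCongr (es.trans (e.trans es'.symm)) f).trans (Equiv.Set.sumCompl s'))
  have hg : ∀ x : I, (g ⟨x, hIB x.2⟩ : ℂ) = e x := by
    intro x
    have hx : (⟨x, hIB x.2⟩ : B) ∈ s := x.2
    simp only [g, Equiv.trans_apply]
    rw [Equiv.Set.sumCompl_symm_apply_of_mem hx]
    simp [es, es']
  refine ⟨b.repr ≪≫ₗ (Finsupp.domLCongr g) ≪≫ₗ b'.repr.symm, fun x => ?_⟩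
  have hbx : (x : ℂ) = b ⟨x, hIB x.2⟩ :=
    (Module.Basis.extend_apply_self hI (⟨x, hIB x.2⟩ : B)).symm
  rw [hbx]
  simp only [LinearEquiv.trans_apply, Module.Basis.repr_self, Finsupp.domLCongr_apply,
    Finsupp.domCongr_apply, Finsupp.equivMapDomain_single, Module.Basis.repr_symm_apply,
    Finsupp.linearCombination_single, one_smul]
  rw [← hg x]
  exact Module.Basis.extend_apply_self hI' _

/-! ### 3. The logarithms `𝓛` of `Kpi = ℚ(π)^{ralg}`; two infinite independent families -/

/-- `𝓛 = {z | e^z ∈ ℚ(π)^{ralg}}`, a `ℚ`-subspace of `ℂ` (closed under `z ↦ z/n` because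
`ℚ(π)^{ralg}` is relatively algebraically closed in `ℂ`). -/
def logKpi : Submodule ℚ ℂ where
  carrier := {z | Complex.exp z ∈ Kpi}
  add_mem' {a b} ha hb := by
    simp only [mem_setOf_eq, Complex.exp_add] at *
    exact mul_mem ha hb
  zero_mem' := by simp
  smul_mem' q z hz := by
    simp only [mem_setOf_eq] at *
    -- `w = exp (q z)` satisfies `w ^ den = (exp z) ^ num ∈ Kpi`
    set w : ℂ := Complex.exp (q • z) with hw
    have hpow : w ^ q.den = Complex.exp z ^ q.num := by
      rw [hw, ← Complex.exp_nat_mul, ← Complex.exp_int_mul, Rat.smul_def, ← mul_assoc]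
      congr 1
      have h : ((q.den : ℚ) * q : ℚ) = q.num := Rat.den_mul_eq_num q
      have h' : ((q.den : ℂ) * (q : ℂ)) = (q.num : ℂ) := by exact_mod_cast h
      rw [h']
    have hc : Complex.exp z ^ q.num ∈ Kpi := zpow_mem hz _
    have halg : IsAlgebraic Kpi w := by
      refine ⟨Polynomial.X ^ q.den - Polynomial.C ⟨_, hc⟩, ?_, ?_⟩
      · exact (Polynomial.monic_X_pow_sub_C _ q.den_nz).ne_zero
      · simp [hpow]
    exact relAlg_closed _ w halg

/-- Membership in `𝓛`. -/
theorem mem_logKpi_iff {z : ℂ} : z ∈ logKpi ↔ Complex.exp z ∈ Kpi := Iff.rfl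

/-- `2πi ∈ 𝓛`. -/
theorem two_pi_I_mem_logKpi : (2 * ↑Real.pi * Complex.I : ℂ) ∈ logKpi := by
  rw [mem_logKpi_iff, Complex.exp_two_pi_mul_I]; exact one_mem _

/-- `ln 2 ∈ 𝓛`. -/
theorem log_two_mem_logKpi : (Real.log 2 : ℂ) ∈ logKpi := by
  rw [mem_logKpi_iff, exp_log_two]; exact natCast_mem Kpi 2

/-- `ln 3 ∈ 𝓛`. -/
theorem log_three_mem_logKpi : (Real.log 3 : ℂ) ∈ logKpi := by
  rw [mem_logKpi_iff, exp_log_three]; exact natCast_mem Kpi 3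

/-- `ln p ∈ 𝓛` for every prime `p`. -/
theorem log_prime_mem_logKpi (p : Nat.Primes) : ((Real.log (p : ℕ) : ℝ) : ℂ) ∈ logKpi := by
  rw [mem_logKpi_iff, ← Complex.ofReal_exp, Real.exp_log (by exact_mod_cast p.2.pos)]
  exact_mod_cast natCast_mem Kpi (p : ℕ)

/-- `ℚ(π)^{ralg}` is countable. -/
theorem countable_Kpi : (Kpi : Set ℂ).Countable :=
  countable_relAlg (countable_adjoin (Set.countable_singleton _))

/-- `𝓛` is countable (countable union of fibres of `exp`). -/
theorem countable_logKpi : (logKpi : Set ℂ).Countable := by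
  have : (logKpi : Set ℂ) = ⋃ c ∈ (Kpi : Set ℂ), {z | Complex.exp z = c} := by
    ext z; simp [mem_logKpi_iff]
  rw [this]
  exact countable_Kpi.biUnion fun c _ => countable_exp_fibre c



/-- `padicValRat` of a finite product of non-zero rationals. -/
theorem padicValRat_prod {p : ℕ} [Fact p.Prime] {ι : Type*} (s : Finset ι) (f : ι → ℚ)
    (hf : ∀ i ∈ s, f i ≠ 0) : padicValRat p (∏ i ∈ s, f i) = ∑ i ∈ s, padicValRat p (f i) := by
  classical
  induction s using Finset.induction_on with
  | empty => simp
  | insert a s ha ih =>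
    rw [Finset.prod_insert ha, Finset.sum_insert ha,
      padicValRat.mul (hf a (Finset.mem_insert_self a s))
        (Finset.prod_ne_zero_iff.2 fun i hi => hf i (Finset.mem_insert_of_mem hi)),
      ih fun i hi => hf i (Finset.mem_insert_of_mem hi)]

/-- The logarithms of the primes are `ℚ`-linearly independent (unique factorisation). -/
theorem linearIndependent_log_primes :
    LinearIndependent ℚ (fun p : Nat.Primes => ((Real.log (p : ℕ) : ℝ) : ℂ)) := by
  rw [← LinearIndependent.iff_fractionRing ℤ ℚ, linearIndependent_iff']
  intro s g hsum p hp
  have hR : ∑ i ∈ s, (g i : ℝ) * Real.log (i : ℕ) = 0 := by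
    apply Complex.ofReal_injective
    push_cast
    simpa [zsmul_eq_mul] using hsum
  have hne : ∀ i ∈ s, (((i : Nat.Primes) : ℕ) : ℝ) ^ (g i) ≠ 0 := fun i _ =>
    zpow_ne_zero _ (by exact_mod_cast i.2.ne_zero)
  have hprod : Real.log (∏ i ∈ s, (((i : ℕ) : ℝ)) ^ (g i)) = 0 := by
    rw [Real.log_prod hne]
    simpa [Real.log_zpow] using hR
  have hpos : 0 < ∏ i ∈ s, (((i : ℕ) : ℝ)) ^ (g i) :=
    Finset.prod_pos fun i _ => zpow_pos (by exact_mod_cast i.2.pos) _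
  have hone : ∏ i ∈ s, (((i : ℕ) : ℝ)) ^ (g i) = 1 := by
    rcases Real.log_eq_zero.1 hprod with h | h | h
    · exact absurd h hpos.ne'
    · exact h
    · linarith
  have hQ : ∏ i ∈ s, (((i : ℕ) : ℚ)) ^ (g i) = 1 := by
    have : ((∏ i ∈ s, (((i : ℕ) : ℚ)) ^ (g i) : ℚ) : ℝ) = 1 := by push_cast; exact hone
    exact_mod_cast this
  haveI : Fact (p : ℕ).Prime := ⟨p.2⟩
  have hval := congrArg (padicValRat (p : ℕ)) hQ
  rw [padicValRat_prod _ _ (fun i _ => zpow_ne_zero _ (by exact_mod_cast i.2.ne_zero)),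
    padicValRat.one] at hval
  simp only [padicValRat.zpow] at hval
  rw [Finset.sum_eq_single p] at hval
  · simpa [padicValRat.self p.2.one_lt] using hval
  · intro i _ hip
    haveI : Fact (i : ℕ).Prime := ⟨i.2⟩
    have hne' : (p : ℕ) ≠ (i : ℕ) := fun h => hip (Subtype.ext h).symm
    have : padicValRat (p : ℕ) ((i : ℕ) : ℚ) = 0 := by
      rw [← padicValRat_of_nat, padicValNat_primes hne']; simp
    simp [this]
  · intro h; exact absurd hp h

/-- The powers of `π` are `ℚ`-linearly independent in `ℂ` (`π` is transcendental). -/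
theorem linearIndependent_pi_pow : LinearIndependent ℚ (fun n : ℕ => (Real.pi : ℂ) ^ n) := by
  classical
  have hπ : Transcendental ℚ (Real.pi : ℂ) := by
    simpa using algebraicIndependent_pi_exp_pi.transcendental 0
  have hinj := transcendental_iff_injective.1 hπ
  rw [linearIndependent_iff']
  intro s g hg i hi
  set P : Polynomial ℚ := ∑ j ∈ s, Polynomial.C (g j) * Polynomial.X ^ j with hP
  have hP0 : Polynomial.aeval (Real.pi : ℂ) P = 0 := by
    rw [hP, map_sum]
    simp only [map_mul, Polynomial.aeval_C, map_pow, Polynomial.aeval_X, eq_ratCast]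
    simpa [Rat.smul_def] using hg
  have hPz : P = 0 := hinj (by rw [hP0, map_zero])
  have hc := congrArg (fun Q : Polynomial ℚ => Q.coeff i) hPz
  simp only [hP, Polynomial.finsetSum_coeff, Polynomial.coeff_C_mul_X_pow,
    Polynomial.coeff_zero] at hc
  simpa [Finset.sum_ite_eq', hi] using hc

/-- `π^n ∈ ℚ(π)^{ralg}`. -/
theorem pi_pow_mem_Kpi (n : ℕ) : (Real.pi : ℂ) ^ n ∈ Kpi := pow_mem pi_mem_Kpi n

/-! ### 4. `τ = 2πi`, `ω = e^π`, `ln 2`, `ln 3`: elementary facts -/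

/-- `τ = 2πi`. -/
abbrev τ : ℂ := 2 * ↑Real.pi * Complex.I
/-- `ω = e^π`. -/
abbrev ω : ℂ := Complex.exp ↑Real.pi
/-- `ln 2`. -/
abbrev L2 : ℂ := (Real.log 2 : ℂ)
/-- `ln 3`. -/
abbrev L3 : ℂ := (Real.log 3 : ℂ)

/-- `τ ≠ 0`. -/
theorem tau_ne_zero : τ ≠ 0 := two_pi_I_ne_zero'
/-- `τ ∈ ℚ(π)^{ralg}`. -/
theorem tau_mem_Kpi : τ ∈ Kpi := two_pi_I_mem_Kpi
/-- `ω = e^π ∉ ℚ(π)^{ralg}` (Nesterenko). -/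
theorem omega_not_mem_Kpi : ω ∉ Kpi := exp_pi_not_mem_Kpi
/-- `ω` is the real number `e^π`. -/
theorem omega_eq_ofReal : ω = ((Real.exp Real.pi : ℝ) : ℂ) := (Complex.ofReal_exp _).symm
/-- `1 < e^π`. -/
theorem one_lt_exp_pi : 1 < Real.exp Real.pi := by
  have := Real.add_one_lt_exp Real.pi_ne_zero
  linarith [Real.pi_pos]
/-- `Im τ = 2π`. -/
theorem tau_im : τ.im = 2 * Real.pi := by simp
/-- `Im ω = 0`. -/
theorem omega_im : ω.im = 0 := by rw [omega_eq_ofReal, Complex.ofReal_im]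

/-- `ω` satisfies no non-trivial quadratic relation over `Kpi` (it is transcendental over the
relatively algebraically closed field `Kpi = ℚ(π)^{ralg}`, Nesterenko). -/
theorem omega_quadratic {a b c : ℂ} (ha : a ∈ Kpi) (hb : b ∈ Kpi) (hc : c ∈ Kpi)
    (h : a * (ω * ω) + b * ω + c = 0) : a = 0 ∧ b = 0 ∧ c = 0 := by
  by_cases ha0 : a = 0
  · subst ha0
    by_cases hb0 : b = 0
    · subst hb0
      refine ⟨rfl, rfl, ?_⟩
      simpa using h
    · exfalso
      apply omega_not_mem_Kpi
      have : ω = -c / b := by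
        field_simp
        linear_combination h
      rw [this]
      exact div_mem (neg_mem hc) hb
  · exfalso
    apply omega_not_mem_Kpi
    let β : Kpi := ⟨b / a, div_mem hb ha⟩
    let γ : Kpi := ⟨c / a, div_mem hc ha⟩
    have halg : IsAlgebraic Kpi ω := by
      refine ⟨Polynomial.X ^ 2 + (Polynomial.C β * Polynomial.X + Polynomial.C γ), ?_, ?_⟩
      · refine (Polynomial.monic_X_pow_add ?_).ne_zero
        exact lt_of_le_of_lt Polynomial.degree_linear_le (by norm_num)
      · have hβ : algebraMap Kpi ℂ β = b / a := rfl
        have hγ : algebraMap Kpi ℂ γ = c / a := rfl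
        simp only [map_add, map_mul, map_pow, Polynomial.aeval_X, Polynomial.aeval_C, hβ, hγ]
        field_simp
        linear_combination h
    exact relAlg_closed _ ω halg

/-- `ω² ∉ ℚ(π)^{ralg}`. -/
theorem omega_sq_not_mem_Kpi : ω * ω ∉ Kpi := fun h => by
  have := omega_quadratic (one_mem _) (zero_mem _) (neg_mem h) (by ring)
  exact one_ne_zero this.1

/-- `τ ≠ ω`. -/
theorem tau_ne_omega : τ ≠ ω := fun h => omega_not_mem_Kpi (h ▸ tau_mem_Kpi)
/-- `τ ≠ ω`. -/
theorem tau_ne_omega_sq : τ ≠ ω * ω := fun h => omega_sq_not_mem_Kpi (h ▸ tau_mem_Kpi)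
/-- `ω ≠ ω²`. -/
theorem omega_ne_omega_sq : ω ≠ ω * ω := fun h => by
  have := omega_quadratic (one_mem _) (neg_mem (one_mem _)) (zero_mem _)
    (by rw [← h]; ring)
  exact one_ne_zero this.1
/-- `τ` is not real. -/
theorem tau_ne_ofReal (r : ℝ) : τ ≠ (r : ℂ) := fun h => by
  have h1 := congrArg Complex.im h
  rw [tau_im, Complex.ofReal_im] at h1
  exact (by positivity : (0 : ℝ) < 2 * Real.pi).ne' h1
/-- `τ ≠ ln 2`. -/
theorem tau_ne_L2 : τ ≠ L2 := tau_ne_ofReal _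
/-- `τ ≠ ln 3`. -/
theorem tau_ne_L3 : τ ≠ L3 := tau_ne_ofReal _
/-- `ln 2 ≠ ln 3`. -/
theorem L2_ne_L3 : L2 ≠ L3 := fun h => by
  have h' : Real.log 2 = Real.log 3 := by exact_mod_cast h
  have := Real.log_lt_log (by norm_num : (0:ℝ) < 2) (by norm_num : (2:ℝ) < 3)
  exact this.ne h'

end StandardKernelTwist

end Summit.Schanuel.Schanuel.Theorems.AclSubsetLogFreeCore.Negative
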